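import Literature.NumberTheory.ComplexMultiplication.CMTorusIsomorphismClassesOrderFinite
import Mathlib.RingTheory.Ideal.IdempotentFG
import HarnessLib

/-!
# The over-orders of an order are precisely its idempotent fractional ideals (Marseglia 2019 Lemma 2.2,
# "by the determinant trick"); the idempotent classes of `ICM(𝔯)`

Family `hodge`, lane `lit-hodgefound` (the seat's "arbitrary order" thread: `CMOrderIdealClassMonoidFinite` §3
«only finitely many over-orders», `CMTorusIsomorphismClassesOrderFinite`), topic
`Literature/NumberTheory/ComplexMultiplication`.  THEOREMS ONLY: no definition, no instance, no named fact
(D-0026, net Literature debt `0`).  Carriers, BY NAME: the order `𝔯 = endOrder ρ` (Q275), Mathlib's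
`FractionalIdeal 𝔯⁰ K` with `spanSingleton`, `*`, `/` (the multiplicator ring `(I : I) = I / I`, as in
`CMOrderEisensteinSingularPrime` §0), the over-orders `{S : Subring K | 𝔯 ≤ S ∧ Module.Finite ℤ S}` of
`CMOrderIdealClassMonoidFinite` §3, the classes `M ∼ N :⟺ M = x·N` of `ICM(𝔯)` (`finite_quot_fractionalIdeal`).

## Source, VERBATIM

S. Marseglia, *Computing the ideal class monoid of an order*, J. London Math. Soc. (2) 101 (2020) 984–1007
[Marseglia2019], held `paper:arxiv-1805.09671`, §2 p. 4 (chunk p0004):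

> A finitely generated sub-`R`-module `I` of `K` is called a fractional `R`-ideal if `I ⊗_ℤ ℚ = K`. […] The
> fractional `R`-ideals that are rings are called over-orders of `R`. […] If `I` is a fractional `R`-ideal
> then `(I:I)` is a sub-ring of `K` containing `R`. Hence it is an over-order of `R` and, in particular, it is
> the biggest over-order of `R` for which `I` is a fractional ideal. It is called the multiplicator ring of `I`.
>
> **Lemma 2.2.** The over-orders of `R` are precisely the idempotents of `𝓘(R)`, that is, the fractional
> `R`-ideals `S` such that `SS = S`.
>
> *Proof.* Let `S` be an over-order of `R`. Then `S` is multiplicatively closed and contains `1`, so `SS = S`.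
> Conversely, let `S` be an idempotent fractional ideal of `R`. Let `T = (S:S)` be the multiplicator ring of
> `S`. As `SS = S` we have `S ⊆ T` and hence `S` is a finitely generated idempotent `T`-ideal. By the
> determinant trick it must be generated by an idempotent element `e` of `T`. As `S` has full rank over `ℤ`
> we must have `e = 1`, that is `S = T`. In particular, `S` is an over-order of `R`.

(§3, p. 6: «`ICM(R) ⊇ ⊔ Pic(S)` where the disjoint union is taken over the set of over-orders `S` of `R`»;
«Write `ICM(R) = ⊔ₑ Gₑ`, where `e` runs over the set of idempotent elements of `ICM(R)`».)

## What is formalised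

* §1 (ANY noetherian domain `R₁` with fraction field `L`, `I : FractionalIdeal R₁⁰ L`, `I ≠ 0`) — the
  determinant-trick half of LEMMA 2.2: `mul_self_eq_of_one_mem_of_mul_self_le` («`S` is multiplicatively
  closed and contains `1`, so `SS = S`»), **`one_mem_of_mul_self_eq`** (`II = I ⟹ 1 ∈ I`: `I` is a finitely
  generated idempotent ideal of the domain `T = (I : I)`, hence `⊥` or `⊤` by Mathlib's
  `Ideal.isIdempotentElem_iff_eq_bot_or_top` — «generated by an idempotent `e` … `e = 1`»),
  `le_div_self_of_mul_self_eq` («as `SS = S` we have `S ⊆ T`»), **`div_self_eq_of_mul_self_eq`** («`S = T`»: an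
  idempotent ideal is its own multiplicator ring), **`mul_self_eq_iff_exists_subring`** (`II = I` iff `I` is
  the underlying set of a subring of `L`).
* §2 (`𝔯 = endOrder ρ ⊂ K`) — LEMMA 2.2 in the tree's vocabulary: `endOrder_le_of_coe_eq_subring`,
  `moduleFinite_of_coe_eq_subring` (a subring of `K` carrying a fractional `𝔯`-ideal contains `𝔯` and is
  module-finite over `ℤ`, i.e. is an over-order), `exists_fractionalIdeal_coe_eq_subring` (an over-order IS a
  nonzero idempotent fractional `𝔯`-ideal), **`mul_self_eq_iff_exists_overorder`** («the over-orders of `R`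
  are precisely the idempotents of `𝓘(R)`»); and on classes **`exists_mul_self_eq_spanSingleton_mul_iff`**:
  `[N]` is an idempotent of `ICM(𝔯)` (`NN = xN`) iff `N = x·S` for an over-order `S` — the idempotents `e` of
  «`ICM(R) = ⊔ₑ Gₑ`» are the classes of the (finitely many, `EndOrder.finite_setOf_overorder`) over-orders.
* §4 THE MULTIPLICATOR RING `(N : N) = N / N` (rider): `one_mem_div_self`, `div_self_ne_zero`,
  `div_self_mul_div_self` (`(N:N)` is a ring), **`exists_overorder_coe_eq_div_self`** («`(I:I)` … is an
  over-order of `R`»), **`spanSingleton_mul_div_spanSingleton_mul`** (`(xN : xN) = (N : N)`: an invariant of the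
  class), **`div_self_eq_of_mul_eq_overorder`** (an ideal invertible in the over-order `S` has multiplicator
  ring `S`) and `overorder_eq_of_invertible_of_invertible` (the `Pic(S) ⊆ ICM(𝔯)` are pairwise disjoint —
  «`ICM(R) ⊇ ⊔ Pic(S)`»).
* §3 VALIDATION `R = ℤ[√-3]`: the non-invertible class `[𝔭₂]` of `ICM(ℤ[√-3]) = {[R], [𝔭₂]}`
  (`CMOrderIdealClassMonoidFinite` §2) is idempotent and its idempotent representative `½𝔭₂` is the over-order
  `ℤ[ζ₃] = 𝒪_K` (`EisensteinTwo.half_primeTwo_mul_self`, `coe_half_primeTwo_eq_span_maximalBasis`,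
  `exists_overorder_primeTwo`): `ICM(ℤ[√-3]) = Pic(ℤ[√-3]) ⊔ Pic(ℤ[ζ₃]) = {[R]} ⊔ {[𝒪_K]}`.

## References
* S. Marseglia, *Computing the ideal class monoid of an order*, J. London Math. Soc. (2) 101 (2020), §2
  Lemma 2.2, p. 4; §3 Prop. 3.? («`ICM(R) ⊇ ⊔ Pic(S)`»), p. 6. [cite: Marseglia2019, §2 Lemma 2.2, p. 4]
* E. C. Dade, O. Taussky, H. Zassenhaus, *On the theory of orders …*, Math. Ann. 148 (1962) 31–64.
  [cite: DadeTausskyZassenhaus1962, §1 (orders and their over-rings)]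
* P. Stevenhagen, *The arithmetic of number rings*, MSRI Publ. 44 (2008), §4 p. 216 (multiplier rings),
  Examples 4.2 p. 217 (`𝔭² = 2𝔭` in `ℤ[√-3]`, multiplier ring `ℤ[α]`). [cite: Stevenhagen2008NumberRings, §4, pp. 216–217]
-/

noncomputable section

open scoped nonZeroDivisors NumberField Pointwise
open NumberField Module FractionalIdeal

namespace Literature.NumberTheory.ComplexMultiplication

namespace EndOrder

/-! ## §1 The determinant trick: a nonzero idempotent fractional ideal of a noetherian domain contains `1`
and is its own multiplicator ring -/

section Domain

variable {R₁ : Type*} [CommRing R₁] [IsDomain R₁] {L : Type*} [Field L] [Algebra R₁ L] [IsFractionRing R₁ L]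

omit [IsDomain R₁] [IsFractionRing R₁ L] in
/-- «`S` is multiplicatively closed and contains `1`, so `SS = S`.» [cite: Marseglia2019, §2 Lemma 2.2 (proof, first half), p. 4] -/
theorem mul_self_eq_of_one_mem_of_mul_self_le {I : FractionalIdeal R₁⁰ L} (h1 : (1 : L) ∈ I) (hle : I * I ≤ I) :
    I * I = I := by
  refine le_antisymm hle fun x hx => ?_
  have h := mul_mem_mul h1 hx
  rwa [one_mul] at h

omit [IsDomain R₁] in
/-- `x·N = x • N` as subsets (bookkeeping between `spanSingleton x * N` and the pointwise action; file-local).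
[folklore] -/
private theorem coe_spanSingleton_mul' (x : L) (I : FractionalIdeal R₁⁰ L) :
    ((spanSingleton R₁⁰ x * I : FractionalIdeal R₁⁰ L) : Set L) = x • (I : Set L) := by
  ext y
  rw [SetLike.mem_coe, mem_singleton_mul, Set.mem_smul_set]
  constructor
  · rintro ⟨y', hy', rfl⟩
    exact ⟨y', hy', rfl⟩
  · rintro ⟨y', hy', rfl⟩
    exact ⟨y', hy', rfl⟩

/-- **The determinant trick (LEMMA 2.2, second half): a nonzero IDEMPOTENT fractional ideal `I = II` of a
noetherian domain contains `1`.**  `I` is a finitely generated idempotent ideal of its multiplicator ring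
`T = (I : I) ⊆ L` (a domain; `I ⊆ T` as `II = I`), hence generated by an idempotent `e ∈ T`, `e ∈ {0, 1}`
(Mathlib `Ideal.isIdempotentElem_iff_eq_bot_or_top`), and `I ≠ 0` forces `e = 1`.
[cite: Marseglia2019, §2 Lemma 2.2 (proof: «By the determinant trick … `e = 1`, that is `S = T`»), p. 4] -/
theorem one_mem_of_mul_self_eq [IsNoetherianRing R₁] {I : FractionalIdeal R₁⁰ L} (hI0 : I ≠ 0)
    (h : I * I = I) : (1 : L) ∈ I := by
  have hmul : ∀ x ∈ I, ∀ y ∈ I, x * y ∈ I := fun x hx y hy => h.le (mul_mem_mul hx hy)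
  -- the multiplicator ring `T = (I : I)` as a subring of `L`
  let T : Subring L :=
    { carrier := {x | ∀ y ∈ I, x * y ∈ I}
      mul_mem' := fun {a b} ha hb y hy => by
        show a * b * y ∈ I
        rw [mul_assoc]
        exact ha _ (hb y hy)
      one_mem' := fun y hy => by
        show 1 * y ∈ I
        rwa [one_mul]
      add_mem' := fun {a b} ha hb y hy => by
        show (a + b) * y ∈ I
        rw [add_mul]
        exact (I : Submodule R₁ L).add_mem (ha y hy) (hb y hy)
      zero_mem' := fun y _ => by
        show 0 * y ∈ I
        rw [zero_mul]
        exact zero_mem I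
      neg_mem' := fun {a} ha y hy => by
        show -a * y ∈ I
        rw [neg_mul]
        exact (I : Submodule R₁ L).neg_mem (ha y hy) }
  have hIT : ∀ x ∈ I, x ∈ T := fun x hx y hy => hmul x hx y hy
  have hRT : ∀ r : R₁, algebraMap R₁ L r ∈ T := fun r y hy => by
    show algebraMap R₁ L r * y ∈ I
    rw [← Algebra.smul_def]
    exact (I : Submodule R₁ L).smul_mem r hy
  -- `I` as an ideal `J` of `T`
  let J : Ideal T :=
    { carrier := {t | (t : L) ∈ I}
      add_mem' := fun {a b} ha hb => by
        show ((a : L) + b) ∈ I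
        exact (I : Submodule R₁ L).add_mem ha hb
      zero_mem' := by
        show ((0 : T) : L) ∈ I
        exact zero_mem I
      smul_mem' := fun c t ht => by
        show ((c : L) * t) ∈ I
        exact c.2 _ ht }
  -- `J` is finitely generated over `T ⊇ R₁`: by the `R₁`-generators of `I`
  obtain ⟨s, hs⟩ : (I : Submodule R₁ L).FG := isNoetherian_iff.1 (isNoetherian I) I le_rfl
  have hsI : ∀ x ∈ (s : Set L), x ∈ I := fun x hx => by
    have hx' : x ∈ (I : Submodule R₁ L) := hs ▸ Submodule.subset_span hx
    exact hx'
  have hspan : ∀ x ∈ Submodule.span R₁ (s : Set L), ∃ hx : x ∈ T,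
      (⟨x, hx⟩ : T) ∈ Ideal.span (((↑) : T → L) ⁻¹' (s : Set L)) := by
    intro x hx
    induction hx using Submodule.span_induction with
    | mem y hy => exact ⟨hIT y (hsI y hy), Ideal.subset_span hy⟩
    | zero => exact ⟨zero_mem T, Submodule.zero_mem _⟩
    | add y z _ _ hy hz =>
      obtain ⟨hyT, hy'⟩ := hy
      obtain ⟨hzT, hz'⟩ := hz
      exact ⟨add_mem hyT hzT, Submodule.add_mem _ hy' hz'⟩
    | smul r y _ hy =>
      obtain ⟨hyT, hy'⟩ := hy
      have hrT : r • y ∈ T := by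
        rw [Algebra.smul_def]
        exact T.mul_mem (hRT r) hyT
      refine ⟨hrT, ?_⟩
      have hmem : (⟨algebraMap R₁ L r, hRT r⟩ * ⟨y, hyT⟩ : T) ∈
          Ideal.span (((↑) : T → L) ⁻¹' (s : Set L)) := Ideal.mul_mem_left _ _ hy'
      convert hmem using 1
      exact Subtype.ext (Algebra.smul_def r y)
  have hJfg : J.FG := by
    refine Submodule.fg_def.2 ⟨((↑) : T → L) ⁻¹' (s : Set L),
      s.finite_toSet.preimage Subtype.coe_injective.injOn, le_antisymm ?_ fun t ht => ?_⟩
    · exact Ideal.span_le.2 fun t ht => hsI _ ht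
    · have ht' : (t : L) ∈ Submodule.span R₁ (s : Set L) := by
        rw [hs]
        exact ht
      obtain ⟨htT, hmem⟩ := hspan _ ht'
      have heq : (⟨(t : L), htT⟩ : T) = t := Subtype.ext rfl
      rw [heq] at hmem
      exact hmem
  -- `J` is idempotent: `I ⊆ I·I` read inside `T`
  have hJJ : IsIdempotentElem J := by
    refine le_antisymm Ideal.mul_le_left fun t ht => ?_
    have hprod : ∀ x ∈ I * I, ∃ hx : x ∈ T, (⟨x, hx⟩ : T) ∈ J * J := by
      intro x hx
      refine FractionalIdeal.mul_induction_on (C := fun x => ∃ hx : x ∈ T, (⟨x, hx⟩ : T) ∈ J * J) hx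
        (fun i hi j hj => ?_) (fun x y hx hy => ?_)
      · exact ⟨hIT _ (hmul i hi j hj),
          Ideal.mul_mem_mul (show (⟨i, hIT i hi⟩ : T) ∈ J from hi) (show (⟨j, hIT j hj⟩ : T) ∈ J from hj)⟩
      · obtain ⟨hxT, hx'⟩ := hx
        obtain ⟨hyT, hy'⟩ := hy
        exact ⟨add_mem hxT hyT, Submodule.add_mem _ hx' hy'⟩
    have ht' : (t : L) ∈ I * I := by
      rw [h]
      exact ht
    obtain ⟨htT, hmem⟩ := hprod _ ht'
    have heq : (⟨(t : L), htT⟩ : T) = t := Subtype.ext rfl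
    rw [heq] at hmem
    exact hmem
  -- a finitely generated idempotent ideal of a domain is `⊥` or `⊤`
  rcases (Ideal.isIdempotentElem_iff_eq_bot_or_top J hJfg).1 hJJ with hbot | htop
  · exfalso
    refine hI0 (eq_zero_iff.2 fun x hx => ?_)
    have hxJ : (⟨x, hIT x hx⟩ : T) ∈ J := hx
    rw [hbot, Ideal.mem_bot] at hxJ
    exact congrArg Subtype.val hxJ
  · have h1 : (1 : T) ∈ J := htop ▸ Submodule.mem_top
    exact h1

/-- «As `SS = S` we have `S ⊆ T`»: an idempotent fractional ideal lies in its multiplicator ring `(I : I) = I / I`.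
[cite: Marseglia2019, §2 Lemma 2.2 (proof), p. 4] -/
theorem le_div_self_of_mul_self_eq {I : FractionalIdeal R₁⁰ L} (hI0 : I ≠ 0) (h : I * I = I) : I ≤ I / I := by
  rw [le_div_iff_mul_le hI0]
  exact h.le

/-- **«`S = T`»: a nonzero idempotent fractional ideal IS its multiplicator ring `(I : I)`** (it contains `1`
by the determinant trick, so `(I : I) = (I : I)·1 ⊆ I`). [cite: Marseglia2019, §2 Lemma 2.2 (proof), p. 4] -/
theorem div_self_eq_of_mul_self_eq [IsNoetherianRing R₁] {I : FractionalIdeal R₁⁰ L} (hI0 : I ≠ 0)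
    (h : I * I = I) : I / I = I := by
  refine le_antisymm (fun x hx => ?_) (le_div_self_of_mul_self_eq hI0 h)
  have hx1 := (mem_div_iff_of_ne_zero hI0).1 hx 1 (one_mem_of_mul_self_eq hI0 h)
  rwa [mul_one] at hx1

/-- **LEMMA 2.2 over any noetherian domain: a nonzero fractional ideal is idempotent, `II = I`, iff it is (the
underlying set of) a subring of `L`** — «the fractional `R`-ideals that are rings».
[cite: Marseglia2019, §2 Lemma 2.2, p. 4] -/
theorem mul_self_eq_iff_exists_subring [IsNoetherianRing R₁] {I : FractionalIdeal R₁⁰ L} (hI0 : I ≠ 0) :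
    I * I = I ↔ ∃ S : Subring L, (S : Set L) = I := by
  constructor
  · intro h
    let S : Subring L :=
      { carrier := I
        mul_mem' := fun {a b} ha hb => h.le (mul_mem_mul ha hb)
        one_mem' := one_mem_of_mul_self_eq hI0 h
        add_mem' := fun {a b} ha hb => (I : Submodule R₁ L).add_mem ha hb
        zero_mem' := zero_mem I
        neg_mem' := fun {a} ha => (I : Submodule R₁ L).neg_mem ha }
    exact ⟨S, rfl⟩
  · rintro ⟨S, hS⟩
    have h1 : (1 : L) ∈ I := by
      have h1S : (1 : L) ∈ (S : Set L) := S.one_mem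
      rw [hS] at h1S
      exact h1S
    refine mul_self_eq_of_one_mem_of_mul_self_le h1 (mul_le.2 fun x hx y hy => ?_)
    have hx' : x ∈ (S : Set L) := by rw [hS]; exact hx
    have hy' : y ∈ (S : Set L) := by rw [hS]; exact hy
    have hxy : x * y ∈ (S : Set L) := S.mul_mem hx' hy'
    rw [hS] at hxy
    exact hxy

end Domain

/-! ## §2 LEMMA 2.2 for the order `𝔯 = endOrder ρ`: over-orders = idempotent fractional ideals; the idempotent
classes of `ICM(𝔯)` -/

section Order

variable {K : Type} [Field K] [NumberField K]
variable {ι : Type} [Fintype ι] [DecidableEq ι] {ρ : K →ₐ[ℚ] Matrix ι ι ℚ}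

/-- The `𝔯`-submodule generated by a subring `S ⊇ 𝔯` of `K` is `S` itself (file-local). [folklore] -/
private theorem coe_span_endOrder_subring {S : Subring K} (h𝔯 : endOrder ρ ≤ S) :
    ((Submodule.span (endOrder ρ) (S : Set K) : Submodule (endOrder ρ) K) : Set K) = S := by
  ext x
  rw [SetLike.mem_coe, SetLike.mem_coe]
  constructor
  · intro hx
    induction hx using Submodule.span_induction with
    | mem y hy => exact hy
    | zero => exact S.zero_mem
    | add y z _ _ hy hz => exact S.add_mem hy hz
    | smul r y _ hy => exact S.mul_mem (h𝔯 r.2) hy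
  · intro hx
    exact Submodule.subset_span hx

/-- A subring of `K` carrying a fractional `𝔯`-ideal contains `𝔯` (`𝔯 = 𝔯·1 ⊆ 𝔯N ⊆ N`). [cite: Marseglia2019, §2
(«`(I:I)` is a sub-ring of `K` containing `R`»), p. 4] -/
theorem endOrder_le_of_coe_eq_subring {N : FractionalIdeal (endOrder ρ)⁰ K} {S : Subring K} (hS : (S : Set K) = N) :
    endOrder ρ ≤ S := by
  intro r hr
  have h1 : (1 : K) ∈ N := by
    have h1S : (1 : K) ∈ (S : Set K) := S.one_mem
    rw [hS] at h1S
    exact h1S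
  have hr1 : (⟨r, hr⟩ : endOrder ρ) • (1 : K) ∈ N := (N : Submodule (endOrder ρ) K).smul_mem ⟨r, hr⟩ h1
  rw [Algebra.smul_def, mul_one] at hr1
  have hr' : r ∈ (S : Set K) := by rw [hS]; exact hr1
  exact hr'

variable [Nonempty ι] [IsFractionRing (endOrder ρ) K]

/-- A subring of `K` carrying a fractional `𝔯`-ideal is module-finite over `ℤ` (the ideal is noetherian over the
noetherian `𝔯`, itself module-finite over `ℤ`) — so it is an over-order in the sense of
`CMOrderIdealClassMonoidFinite` §3. [cite: Marseglia2019, §2 («a finitely generated sub-`R`-module»), p. 4] -/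
theorem moduleFinite_of_coe_eq_subring {N : FractionalIdeal (endOrder ρ)⁰ K} {S : Subring K}
    (hS : (S : Set K) = N) : Module.Finite ℤ S := by
  haveI := CMTypeLattice.isNoetherianRing_endOrder ρ
  haveI : Module.Finite ℤ (endOrder ρ) := CMTypeLattice.finite_endOrder ρ
  haveI : IsNoetherian (endOrder ρ) N := isNoetherian N
  haveI : Module.Finite (endOrder ρ) N := inferInstance
  haveI : Module.Finite ℤ N := Module.Finite.trans (endOrder ρ) N
  have hmem : ∀ x : K, x ∈ N ↔ x ∈ S := fun x => by
    have hx : x ∈ (N : Set K) ↔ x ∈ (S : Set K) := by rw [hS]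
    exact hx
  let e : N ≃+ S :=
    { toFun := fun n => ⟨n.1, (hmem n.1).1 n.2⟩
      invFun := fun s => ⟨s.1, (hmem s.1).2 s.2⟩
      left_inv := fun _ => rfl
      right_inv := fun _ => rfl
      map_add' := fun _ _ => rfl }
  exact Module.Finite.equiv e.toIntLinearEquiv

omit [Nonempty ι] in
/-- **An over-order IS a nonzero idempotent fractional `𝔯`-ideal** (module-finite over `ℤ` ⟹ finitely
generated over `𝔯` ⟹ fractional; a ring ∋ `1` ⟹ `SS = S`, `S ≠ 0`). [cite: Marseglia2019, §2 Lemma 2.2 (first half), p. 4] -/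
theorem exists_fractionalIdeal_coe_eq_subring {S : Subring K} (h𝔯 : endOrder ρ ≤ S) (hfin : Module.Finite ℤ S) :
    ∃ M : FractionalIdeal (endOrder ρ)⁰ K, M ≠ 0 ∧ M * M = M ∧ (M : Set K) = S := by
  classical
  -- `S` is finitely generated over `𝔯`: by its `ℤ`-generators
  have hfg : (Submodule.span (endOrder ρ) (S : Set K) : Submodule (endOrder ρ) K).FG := by
    obtain ⟨s, hs⟩ := Module.finite_def.1 hfin
    refine ⟨s.image (fun x : S => (x : K)), le_antisymm (Submodule.span_mono ?_) (Submodule.span_le.2 fun x hx => ?_)⟩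
    · rw [Finset.coe_image]
      rintro _ ⟨x, -, rfl⟩
      exact x.2
    · have hx' : (⟨x, hx⟩ : S) ∈ Submodule.span ℤ (s : Set S) := by
        rw [hs]
        exact Submodule.mem_top
      have himg := Submodule.apply_mem_span_image_of_mem_span (S.subtype.toIntLinearMap) hx'
      rw [Finset.coe_image]
      exact Submodule.span_subset_span ℤ (endOrder ρ) _ himg
  set M : FractionalIdeal (endOrder ρ)⁰ K := ⟨Submodule.span (endOrder ρ) (S : Set K), isFractional_of_fg hfg⟩
    with hM
  have hMcoe : (M : Set K) = S := coe_span_endOrder_subring h𝔯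
  have h1 : (1 : K) ∈ M := by
    have h1' : (1 : K) ∈ (M : Set K) := by rw [hMcoe]; exact S.one_mem
    exact h1'
  refine ⟨M, fun h0 => ?_, mul_self_eq_of_one_mem_of_mul_self_le h1 (mul_le.2 fun x hx y hy => ?_), hMcoe⟩
  · rw [h0] at h1
    exact one_ne_zero ((mem_zero_iff _).1 h1)
  · have hx' : x ∈ (M : Set K) := hx
    have hy' : y ∈ (M : Set K) := hy
    rw [hMcoe] at hx' hy'
    have hxy : x * y ∈ (M : Set K) := by rw [hMcoe]; exact S.mul_mem hx' hy'
    exact hxy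

/-- **LEMMA 2.2 (Marseglia): «The over-orders of `R` are precisely the idempotents of `𝓘(R)`, that is, the
fractional `R`-ideals `S` such that `SS = S`»** — for the order `𝔯 = endOrder ρ` of `K`, with over-orders as in
`CMOrderIdealClassMonoidFinite` §3 (subrings `𝔯 ≤ S` module-finite over `ℤ`). [cite: Marseglia2019, §2 Lemma 2.2, p. 4] -/
theorem mul_self_eq_iff_exists_overorder {N : FractionalIdeal (endOrder ρ)⁰ K} (hN0 : N ≠ 0) :
    N * N = N ↔ ∃ S : Subring K, endOrder ρ ≤ S ∧ Module.Finite ℤ S ∧ (S : Set K) = N := by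
  haveI := CMTypeLattice.isNoetherianRing_endOrder ρ
  rw [mul_self_eq_iff_exists_subring hN0]
  exact ⟨fun ⟨S, hS⟩ => ⟨S, endOrder_le_of_coe_eq_subring hS, moduleFinite_of_coe_eq_subring hS, hS⟩,
    fun ⟨S, _, _, hS⟩ => ⟨S, hS⟩⟩

/-- **An idempotent fractional ideal is its own multiplicator ring: `NN = N ≠ 0 ⟹ (N : N) = N`** (for the order
`𝔯`; the multiplier ring `Λ(N) = N / N` of `CMOrderEisensteinSingularPrime` §0). [cite: Marseglia2019, §2 Lemma 2.2 (proof, «`S = T`»), p. 4]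
[cite: Stevenhagen2008NumberRings, §4, p. 216] -/
theorem div_self_eq_of_mul_self_eq_endOrder {N : FractionalIdeal (endOrder ρ)⁰ K} (hN0 : N ≠ 0) (h : N * N = N) :
    N / N = N := by
  haveI := CMTypeLattice.isNoetherianRing_endOrder ρ
  exact div_self_eq_of_mul_self_eq hN0 h

/-- **The idempotents of `ICM(𝔯)` are the classes of the over-orders**: `[N][N] = [N]`, i.e. `NN = x·N` for some
`x ∈ K^×`, iff `N = x·S` for an over-order `S` of `𝔯` (`x⁻¹N` is then an idempotent fractional ideal, LEMMA 2.2)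
— the `e` of «`ICM(R) = ⊔ₑ Gₑ`, where `e` runs over the set of idempotent elements of `ICM(R)`»; they are finitely
many (`EndOrder.finite_setOf_overorder`). [cite: Marseglia2019, §2 Lemma 2.2 and §3 (proof of Prop. 3.?: «`ICM(R) = ⊔ₑ Gₑ`»), pp. 4, 6] -/
theorem exists_mul_self_eq_spanSingleton_mul_iff {N : FractionalIdeal (endOrder ρ)⁰ K} (hN0 : N ≠ 0) :
    (∃ x : K, x ≠ 0 ∧ N * N = spanSingleton (endOrder ρ)⁰ x * N) ↔
      ∃ x : K, x ≠ 0 ∧ ∃ S : Subring K, endOrder ρ ≤ S ∧ Module.Finite ℤ S ∧ (N : Set K) = x • (S : Set K) := by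
  constructor
  · rintro ⟨x, hx0, hx⟩
    -- `M = x⁻¹N` is idempotent
    set M : FractionalIdeal (endOrder ρ)⁰ K := spanSingleton (endOrder ρ)⁰ x⁻¹ * N with hM
    have hNM : spanSingleton (endOrder ρ)⁰ x * M = N := by
      rw [hM, ← mul_assoc, spanSingleton_mul_spanSingleton, mul_inv_cancel₀ hx0, spanSingleton_one, one_mul]
    have hM0 : M ≠ 0 := fun h0 => hN0 (by rw [← hNM, h0, mul_zero])
    have hMM : M * M = M := by
      rw [hM, mul_mul_mul_comm, spanSingleton_mul_spanSingleton, hx, ← mul_assoc, spanSingleton_mul_spanSingleton,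
        inv_mul_cancel_right₀ hx0]
    obtain ⟨S, h𝔯, hfin, hS⟩ := (mul_self_eq_iff_exists_overorder hM0).1 hMM
    refine ⟨x, hx0, S, h𝔯, hfin, ?_⟩
    rw [hS, hM, coe_spanSingleton_mul', smul_inv_smul₀ hx0]
  · rintro ⟨x, hx0, S, h𝔯, hfin, hNS⟩
    obtain ⟨M, -, hMM, hMS⟩ := exists_fractionalIdeal_coe_eq_subring h𝔯 hfin
    have hN : N = spanSingleton (endOrder ρ)⁰ x * M :=
      SetLike.coe_injective (by rw [coe_spanSingleton_mul', hMS, hNS])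
    refine ⟨x, hx0, ?_⟩
    rw [hN, mul_mul_mul_comm, hMM, ← mul_assoc, spanSingleton_mul_spanSingleton]

end Order

end EndOrder

/-! ## §3 Validation: `ICM(ℤ[√-3]) = {[R]} ⊔ {[𝒪_K]}` — the non-invertible class is the class of the over-order
`ℤ[ζ₃] = ½𝔭₂` -/

namespace CMTypeLattice

namespace EisensteinTwo

/-- **`½𝔭₂` is idempotent**: `(½𝔭₂)(½𝔭₂) = ¼·𝔭₂𝔭₂ = ¼·2𝔭₂ = ½𝔭₂` (`𝔭₂𝔭₂ = 2𝔭₂`,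
`coe_primeTwo_mul_primeTwo`). [cite: Stevenhagen2008NumberRings, §4 Examples 4.2 («`𝔭² = 2𝔭`»), p. 217]
[cite: Marseglia2019, §2 Lemma 2.2, p. 4] -/
theorem half_primeTwo_mul_self :
    (spanSingleton (endOrder (Algebra.leftMulMatrix basis))⁰ (2⁻¹ : K₃) * primeTwo) *
        (spanSingleton (endOrder (Algebra.leftMulMatrix basis))⁰ (2⁻¹ : K₃) * primeTwo) =
      spanSingleton (endOrder (Algebra.leftMulMatrix basis))⁰ (2⁻¹ : K₃) * primeTwo := by
  rw [mul_mul_mul_comm, spanSingleton_mul_spanSingleton, coe_primeTwo_mul_primeTwo, ← mul_assoc,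
    spanSingleton_mul_spanSingleton, inv_mul_cancel_right₀ (two_ne_zero : (2 : K₃) ≠ 0)]

/-- **… and `½𝔭₂ = ℤ[ζ₃] = 𝒪_K`**: the idempotent representative of the non-invertible class `[𝔭₂]` is the
maximal order, the over-order `Λ(𝔭₂) = ℤ[ζ₃] ⊋ R` («the nonprincipal ideals have multiplier ring `ℤ[α] ⊋ R`»).
[cite: Stevenhagen2008NumberRings, §4 Examples 4.2, p. 217] [cite: Marseglia2019, §2 Lemma 2.2, p. 4] -/
theorem coe_half_primeTwo_eq_span_maximalBasis :
    ((spanSingleton (endOrder (Algebra.leftMulMatrix basis))⁰ (2⁻¹ : K₃) * primeTwo :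
        FractionalIdeal (endOrder (Algebra.leftMulMatrix basis))⁰ K₃) : Set K₃) =
      (Submodule.span ℤ (Set.range maximalBasis) : Set K₃) := by
  ext y
  rw [SetLike.mem_coe, mem_singleton_mul, SetLike.mem_coe]
  constructor
  · rintro ⟨z, hz, rfl⟩
    have hz' : z ∈ ((primeTwo : FractionalIdeal (endOrder (Algebra.leftMulMatrix basis))⁰ K₃) : Set K₃) := hz
    rw [coe_primeTwo_eq_smul_span_maximalBasis] at hz'
    obtain ⟨w, hw, rfl⟩ := Set.mem_smul_set.1 hz'
    rwa [smul_eq_mul, inv_mul_cancel_left₀ (two_ne_zero : (2 : K₃) ≠ 0)]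
  · intro hy
    refine ⟨2 * y, ?_, by rw [inv_mul_cancel_left₀ (two_ne_zero : (2 : K₃) ≠ 0)]⟩
    have h2y : 2 * y ∈ ((primeTwo : FractionalIdeal (endOrder (Algebra.leftMulMatrix basis))⁰ K₃) : Set K₃) := by
      rw [coe_primeTwo_eq_smul_span_maximalBasis]
      exact Set.smul_mem_smul_set hy
    exact h2y

/-- **The class `[𝔭₂]` is the class of an over-order** (`𝔭₂ = 2·S`, `S = ℤ[ζ₃]`): in `ICM(ℤ[√-3]) = {[R], [𝔭₂]}`
both classes are idempotent, `ICM(ℤ[√-3]) = Pic(ℤ[√-3]) ⊔ Pic(ℤ[ζ₃])` with both Picard groups trivial («every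
order in a quadratic number field is a Bass order», `ICM(R) = ⊔ Pic(S)`). [cite: Marseglia2019, §3 («`ICM(R) ⊇ ⊔ Pic(S)`», equality for Bass orders), p. 6]
[cite: Stevenhagen2008NumberRings, Example 6.9 and Examples 4.2, pp. 217, 226] -/
theorem exists_overorder_primeTwo :
    ∃ x : K₃, x ≠ 0 ∧ ∃ S : Subring K₃, endOrder (Algebra.leftMulMatrix basis) ≤ S ∧ Module.Finite ℤ S ∧
      (((primeTwo : FractionalIdeal (endOrder (Algebra.leftMulMatrix basis))⁰ K₃)) : Set K₃) = x • (S : Set K₃) :=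
  (EndOrder.exists_mul_self_eq_spanSingleton_mul_iff (coeIdeal_ne_zero.2 primeTwo_ne_bot)).1
    ⟨2, two_ne_zero, coe_primeTwo_mul_primeTwo⟩

end EisensteinTwo

end CMTypeLattice

/-! ## §4 The multiplicator ring `(N : N) = N / N`: an over-order, an invariant of the class `[N] ∈ ICM(𝔯)`, and
`= S` for every ideal invertible in the over-order `S` — «`ICM(R) ⊇ ⊔ Pic(S)`» (Marseglia §2–§3) -/

namespace EndOrder

section MultiplicatorRing

variable {K : Type} [Field K] [NumberField K]
variable {ι : Type} [Fintype ι] [DecidableEq ι] {ρ : K →ₐ[ℚ] Matrix ι ι ℚ}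
variable [IsFractionRing (endOrder ρ) K]

/-- `1 ∈ (N : N)`. [cite: Marseglia2019, §2 («`(I:I)` is a sub-ring of `K` containing `R`»), p. 4] -/
theorem one_mem_div_self {N : FractionalIdeal (endOrder ρ)⁰ K} (hN0 : N ≠ 0) : (1 : K) ∈ N / N :=
  (mem_div_iff_of_ne_zero hN0).2 fun y hy => by rwa [one_mul]

/-- `(N : N) ≠ 0`. [cite: Marseglia2019, §2, p. 4] -/
theorem div_self_ne_zero {N : FractionalIdeal (endOrder ρ)⁰ K} (hN0 : N ≠ 0) : N / N ≠ 0 := fun h => by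
  have h1 := one_mem_div_self hN0
  rw [h] at h1
  exact one_ne_zero ((mem_zero_iff _).1 h1)

/-- **`(N : N)` is a ring**: the multiplicator ring is an idempotent fractional ideal, `(N:N)(N:N) = (N:N)`.
[cite: Marseglia2019, §2 («`(I:I)` is a sub-ring of `K`» and Lemma 2.2), p. 4] -/
theorem div_self_mul_div_self {N : FractionalIdeal (endOrder ρ)⁰ K} (hN0 : N ≠ 0) : N / N * (N / N) = N / N :=
  mul_self_eq_of_one_mem_of_mul_self_le (one_mem_div_self hN0) (mul_le.2 fun x hx y hy =>
    (mem_div_iff_of_ne_zero hN0).2 fun n hn => by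
      rw [mul_assoc]
      exact (mem_div_iff_of_ne_zero hN0).1 hx _ ((mem_div_iff_of_ne_zero hN0).1 hy n hn))

variable [Nonempty ι]

/-- **«If `I` is a fractional `R`-ideal then `(I:I)` is a sub-ring of `K` containing `R`. Hence it is an
over-order of `R`»** — the multiplicator ring of every nonzero fractional `𝔯`-ideal is one of the (finitely many,
`finite_setOf_overorder`) over-orders of `𝔯`. [cite: Marseglia2019, §2, p. 4] -/
theorem exists_overorder_coe_eq_div_self {N : FractionalIdeal (endOrder ρ)⁰ K} (hN0 : N ≠ 0) :
    ∃ S : Subring K, endOrder ρ ≤ S ∧ Module.Finite ℤ S ∧ (S : Set K) = ((N / N : FractionalIdeal (endOrder ρ)⁰ K) : Set K) :=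
  (mul_self_eq_iff_exists_overorder (div_self_ne_zero hN0)).1 (div_self_mul_div_self hN0)

omit [Nonempty ι] in
/-- **The multiplicator ring is an invariant of the ideal class: `(xN : xN) = (N : N)`** (`x ∈ K^×`), so
`[N] ↦ (N : N)` is well defined on `ICM(𝔯)`. [cite: Marseglia2019, §3 (the partition of `ICM(R)` by multiplicator rings), p. 6]
[cite: Stevenhagen2008NumberRings, §4 Examples 4.2 («`Λ(xI) = Λ(I)`»), p. 217] -/
theorem spanSingleton_mul_div_spanSingleton_mul {N : FractionalIdeal (endOrder ρ)⁰ K} {x : K} (hx : x ≠ 0)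
    (hN0 : N ≠ 0) :
    spanSingleton (endOrder ρ)⁰ x * N / (spanSingleton (endOrder ρ)⁰ x * N) = N / N := by
  have hxN0 : spanSingleton (endOrder ρ)⁰ x * N ≠ 0 := fun h0 => hN0 (by
    rw [← one_mul N, ← spanSingleton_one, ← inv_mul_cancel₀ hx, ← spanSingleton_mul_spanSingleton, mul_assoc, h0,
      mul_zero])
  ext y
  rw [mem_div_iff_of_ne_zero hxN0, mem_div_iff_of_ne_zero hN0]
  constructor
  · intro h n hn
    obtain ⟨n', hn', h'⟩ := mem_singleton_mul.1 (h (x * n) (mem_singleton_mul.2 ⟨n, hn, rfl⟩))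
    have hyn : y * n = n' := mul_left_cancel₀ hx (by rw [← h', mul_left_comm])
    rw [hyn]
    exact hn'
  · intro h m hm
    obtain ⟨n, hn, rfl⟩ := mem_singleton_mul.1 hm
    rw [mul_left_comm]
    exact mem_singleton_mul.2 ⟨y * n, h n hn, rfl⟩

/-- **«Let `I` be a fractional ideal which is invertible in [the over-order `S`]. Then `S` is the multiplicator
ring of `I`»**: for an idempotent `M = MM ≠ 0` (an over-order, LEMMA 2.2), an `M`-ideal `N` (`MN = N`) with an
`M`-inverse (`NN′ = M`) has `(N : N) = M` («`Λ(I) = Λ(I)I·I⁻¹ ⊂ I·I⁻¹`»; the case `M = 𝔯` is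
`fractionalIdeal_div_self_of_isUnit`). [cite: Marseglia2019, §2 (invertible ⟹ multiplicator ring), p. 4]
[cite: Stevenhagen2008NumberRings, §4, p. 216] -/
theorem div_self_eq_of_mul_eq_overorder {M N N' : FractionalIdeal (endOrder ρ)⁰ K} (hMM : M * M = M) (hM0 : M ≠ 0)
    (hMN : M * N = N) (hNN' : N * N' = M) : N / N = M := by
  haveI := CMTypeLattice.isNoetherianRing_endOrder ρ
  have hN0 : N ≠ 0 := fun h => hM0 (by rw [← hNN', h, zero_mul])
  have h1M : (1 : K) ∈ M := one_mem_of_mul_self_eq hM0 hMM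
  refine le_antisymm (fun y hy => ?_) fun m hm => (mem_div_iff_of_ne_zero hN0).2 fun n hn => hMN.le (mul_mem_mul hm hn)
  -- `yM = yNN′ ⊆ NN′ = M`, so `y = y·1 ∈ M`
  have hyN : spanSingleton (endOrder ρ)⁰ y * N ≤ N := spanSingleton_mul_le_iff.2 ((mem_div_iff_of_ne_zero hN0).1 hy)
  have hyM : spanSingleton (endOrder ρ)⁰ y * M ≤ M :=
    calc spanSingleton (endOrder ρ)⁰ y * M = spanSingleton (endOrder ρ)⁰ y * N * N' := by rw [← hNN', mul_assoc]
      _ ≤ N * N' := mul_le_mul_of_nonneg_right hyN (zero_le N')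
      _ = M := hNN'
  have hy1 := spanSingleton_mul_le_iff.1 hyM 1 h1M
  rwa [mul_one] at hy1

/-- **The `Pic(S)` inside `ICM(𝔯)` are DISJOINT for distinct over-orders**: if `N` is invertible in the over-order
`M₁` and a member `x·N` of its class is invertible in the over-order `M₂`, then `M₁ = M₂` (both are the
multiplicator ring of the class) — «`ICM(R) ⊇ ⊔ Pic(S)` where the disjoint union is taken over the set of
over-orders `S` of `R`». [cite: Marseglia2019, §3 («`ICM(R) ⊇ ⊔ Pic(S)`»), p. 6] -/
theorem overorder_eq_of_invertible_of_invertible {M₁ M₂ N N₁ N₂ : FractionalIdeal (endOrder ρ)⁰ K} {x : K} (hx : x ≠ 0)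
    (h₁ : M₁ * M₁ = M₁) (h₁0 : M₁ ≠ 0) (h₁N : M₁ * N = N) (hN₁ : N * N₁ = M₁)
    (h₂ : M₂ * M₂ = M₂) (h₂0 : M₂ ≠ 0) (h₂N : M₂ * (spanSingleton (endOrder ρ)⁰ x * N) = spanSingleton (endOrder ρ)⁰ x * N)
    (hN₂ : spanSingleton (endOrder ρ)⁰ x * N * N₂ = M₂) : M₁ = M₂ := by
  have hN0 : N ≠ 0 := fun h => h₁0 (by rw [← hN₁, h, zero_mul])
  rw [← div_self_eq_of_mul_eq_overorder h₁ h₁0 h₁N hN₁, ← div_self_eq_of_mul_eq_overorder h₂ h₂0 h₂N hN₂,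
    spanSingleton_mul_div_spanSingleton_mul hx hN0]

end MultiplicatorRing

end EndOrder

end Literature.NumberTheory.ComplexMultiplication
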